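import Literature.NumberTheory.EllipticCurves.KatoTwistedFiniteness
import Literature.NumberTheory.EllipticCurves.IwasawaSelmer
import Literature.NumberTheory.EllipticCurves.CyclotomicZpExtensionLayerTorsionTwoProofs
import HarnessLib

/-!
# BSD family — Kato 2004, Cor. 14.3 (1) of Thm. 14.2 (2) for `E/ℚ` over the LAYERS `ℚ_n` (`n ≥ 1`) of the cyclotomic
# `ℤ₂`-extension, `p = 2`, in the tree's SUBGROUP model of Selmer groups (named fact; the layer twin of
# `KatoTwistedSelmerFiniteness.lean`)

Topic `Literature/NumberTheory/EllipticCurves`.  ONE named fact (`def … : Prop`, D-0014: a PUBLISHED theorem, statement only,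
nothing asserted, no `_holds`; net debt +1), no proofs, no instance, no notation.

K. Kato, *`p`-adic Hodge theory and values of zeta functions of modular forms*, Astérisque 295 (2004), §14.1 / Thm. 14.2 /
Cor. 14.3 (p. 235): for the newform `f` of `E/ℚ`, the prime `p` fixed in 14.1 (ARBITRARY — here `p = 2`), a finite abelian
extension `K/ℚ` with `m` minimal such that `K ⊂ ℚ(ζ_m)`, `S = prime(m)`, and a character `χ` of `Gal(K/ℚ)` with
`L_S(f, χ, 1) ≠ 0`: «the `χ`-part `Sel(K, A ⊗_ℚ K)^{(χ)}` of `Sel(K, A ⊗_ℚ K)` is finite» (Cor. 14.3 (1), `A = E`), where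
`M^{(χ)} = {x ∈ M ; I_χ x = 0}`, `I_χ = Ker(ℤ[Gal(K/ℚ)] → ℂ)` (display after Thm. 14.2) — the tree's `chiPart`.

THIS FILE reads it for `K = ℚ_n`, the `n`-th layer (`n ≥ 1`) of the cyclotomic `ℤ₂`-extension of `ℚ` (Washington §13.1:
`ℚ_n = ℚ(ζ_{2^{n+2}})⁺`, so `m = 2^{n+2}`, `S = {2}`, and `L_S(f,χ,s) = Σ_{(m',2)=1} a_{m'} χ(m') m'^{-s}` is LITERALLY the tree's
`twistedLSeries f χ` for the EVEN Dirichlet character `χ` mod `2^{n+2}` defining the character of `Gal(ℚ_n/ℚ) = (ℤ/2^{n+2})ˣ/{±1}`), on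
the SUBGROUP model `Sel_{2^∞}(E/ℚ_n) = W.selmerLayer κ n ⊆ H¹(Gal(ℚ̄/ℚ_n), E[2^∞]) = W.subgroupH1 2 (κ.layerSubgroup n)` with the
`Gal(ℚ_n/ℚ)`-action by conjugation `W.conjH1` (inner automorphisms act trivially) and `χ` read on `Γ_ℚ` through
`modNCyclotomicCharacter ℚ (2^{n+2})` (Kato's `(ℤ/m)ˣ ≅ Gal(ℚ(ζ_m)/ℚ)`, p. 235).  The sibling `kato_finite_chiPart_selmer_of_twistedLValue_ne_zero`
(`KatoTwistedSelmerFiniteness.lean`) is the same corollary on the BASE-CHANGE model over `ℚ(ζ_m)`; the tree has no comparison between the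
two models, hence this separate reading (cell `bsd-2adic`, director-bsd (830) «G1b»; text of record tower-1 GEN 64
`run/shared/lean/pub/bsd-2adic/tower/gen64/G1b-binder-text.lean` @1f13ee07bab4991b, pen-elaborated RC-767; consumer =
`Summits/…/Theorems/ByReductionTypeAtTwoSupersingularSelmerCorankCyclotomicLayersBounded.lean`, binder `hKato` BYTE-FOR-BYTE).
Why `1 ≤ n`: for `n = 0` (`K = ℚ`, `m = 1`, `S = ∅`) the mod-`4` spelling would differ from print by the Euler factor at `2`.
Deliberately NOT here: Kato's Euler system (§§8–13, 14.6–14.22), general abelian `K`, odd `p` layers, any proof.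
-- TODO(general form): arbitrary finite abelian `K/ℚ` and `χ` (Cor. 14.3 as printed), all primes `p`, the model comparison.

## References

* K. Kato, Astérisque 295 (2004), 117–290: §14.1, Thm. 14.2 (2), Cor. 14.3 (1)(2) and the display after Thm. 14.2 (p. 235). [Kato2004Asterisque]
* L. C. Washington, *Introduction to Cyclotomic Fields*, 2nd ed., §13.1 (the layers of the cyclotomic `ℤ_p`-extension). [Washington1997]
-/

noncomputable section

open scoped Classical

open WeierstrassCurve CongruenceSubgroup

namespace Literature.NumberTheory.EllipticCurves

open GaloisRepresentations ModularForms

/-- **Kato 2004, Cor. 14.3 (1) of Thm. 14.2 (2) (p. 235), for `E/ℚ` over the `n`-th layer `K = ℚ_n` (`n ≥ 1`) of the cyclotomic `ℤ₂`-extension,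
`p = 2`, in the tree's SUBGROUP model.**  Kato, §14.1 / Thm. 14.2 / Cor. 14.3 (p. 235): for the newform `f` of `E/ℚ` (`IsNewformOf W f`), a finite
abelian extension `K/ℚ`, `m` the least integer with `K ⊂ ℚ(ζ_m)`, `S = prime(m)`, and a character `χ : Gal(K/ℚ) → ℂ^×` with `L_S(f, χ, 1) ≠ 0`:
«the `χ`-part `Sel(K, A ⊗_ℚ K)^{(χ)}` of `Sel(K, A ⊗_ℚ K)` is finite» (Cor. 14.3 (1), `A = E`; `M^{(χ)} = {x ∈ M ; I_χ x = 0}`, `I_χ = Ker(ℤ[Gal(K/ℚ)] → ℂ)`,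
display after Thm. 14.2), `p` being the arbitrary prime fixed in 14.1 — here `p = 2`.  READ for `K = ℚ_n`, `n ≥ 1`: `m = 2^{n+2}`, `S = {2}`, so
`L_S(f, χ, s) = Σ_{(m',2)=1} a_{m'} χ(m') m'^{−s}` is LITERALLY `twistedLSeries f χ` for `χ` the EVEN Dirichlet character mod `2^{n+2}` defining the
character of `Gal(ℚ_n/ℚ) = (ℤ/2^{n+2})ˣ/{±1}` (`χ.Even`; «`L ≠ 0` at `1`» = some entire continuation of `twistedLSeries f χ` is non-zero at `1`, the
tree's idiom of `kato_finite_chiPart_selmer_of_twistedLValue_ne_zero`); `χ` is read on `Γ_ℚ` through `modNCyclotomicCharacter ℚ (2^{n+2})`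
(Kato's identification `(ℤ/m)ˣ ≅ Gal(ℚ(ζ_m)/ℚ)`, p. 235); `Gal(ℚ_n/ℚ)` acts on `Sel_{2^∞}(E/ℚ_n) = W.selmerLayer κ n ⊆ H¹(Gal(ℚ̄/ℚ_n), E[2^∞]) =
W.subgroupH1 2 (κ.layerSubgroup n)` by conjugation `W.conjH1` (inner automorphisms act trivially).  For `n = 0` (`K = ℚ`, `S = ∅`) the mod-4 spelling
would differ from print by the Euler factor at `2`, hence `1 ≤ n`.  Text of record: cell `bsd-2adic`, tower-1 GEN 64, `HOME/tower/gen64/G1b-binder-text.lean`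
@1f13ee07bab4991b (= the binder `hKato` of `TowerHaMa.selmerCorank_cyclotomicLayers_bounded_of_goodSS_two`, BYTE-FOR-BYTE; pen GEN 40 RC-767: elaborates).
SCOPE LINE (pen GEN 40 RC-767 §2, deltas vs the base-change sibling `kato_finite_chiPart_selmer_of_twistedLValue_ne_zero`, `KatoTwistedSelmerFiniteness.lean`
:69 — all MODEL/INSTANCE, none strengthens print): (δ1) `K = ℚ(ζ_m)` base-change model ↦ `K = ℚ_n` SUBGROUP model (`W.selmerLayer κ n ⊆
W.subgroupH1 2 (κ.layerSubgroup n)`, `G = Γ_ℚ`, `ρ = W.conjH1 2 (κ.layerSubgroup n)`, factoring through `Gal(ℚ_n/ℚ)` since the inner action is trivial =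
Kato's `σ_*` on `H¹(K, ·)`); (δ2) `χ` EVEN mod `2^{n+2}` read through `modNCyclotomicCharacter ℚ (2^(n+2))` (characters of `Gal(ℚ_n/ℚ) = (ℤ/2^{n+2})ˣ/{±1}`;
printed scope «`χ` a character of `Gal(K/ℚ)`, `K` finite abelian»); (δ3) `p = 2` (an INSTANCE of the printed «every `p`»); (δ4) `m % 4 ≠ 2` dropped
(`m = 2^{n+2} ≥ 8`); (δ5) `1 ≤ n` ADDED so that `L_S(f,χ,s)` is literally `twistedLSeries f χ`.  A faithful layer-form INSTANCE of Cor. 14.3 (1); weaker than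
print only by instantiation.  NAMED FACT; NOTHING ASSERTED; no `_holds` (Kato's Euler-system proof, §§8–14, is not in the tree).
-- TODO(general form): arbitrary finite abelian `K/ℚ` and `χ` (Kato's Cor. 14.3 as printed), the base-change model, `n = 0` with `L_∅ = L`.
[cite: Kato2004Asterisque, §14.1, Thm. 14.2 (2) and Cor. 14.3 (1) (p. 235)] [cite: Washington1997, §13.1 (`ℚ_n = ℚ(ζ_{2^{n+2}})⁺`)] -/
def kato_finite_chiPart_selmerLayer_of_twistedLValue_ne_zero : Prop :=
  ∀ (W : WeierstrassCurve ℚ) [W.IsElliptic] {N : ℕ} [NeZero N] {f : CuspForm (Gamma0 N) 2}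
      (_hf : IsNewformOf W f) (κ : ZpExtension ℚ 2) (_hκ : κ.IsCyclotomic) (n : ℕ) (_hn : 1 ≤ n)
      (χ : DirichletCharacter ℂ (2 ^ (n + 2))) (_hχ : χ.Even)
      (_hL : ∃ L : ℂ → ℂ, Differentiable ℂ L ∧
        (∀ s : ℂ, 2 < s.re → L s = twistedLSeries f χ s) ∧ L 1 ≠ 0),
      Finite ↥(chiPart (fun σ : Field.absoluteGaloisGroup ℚ => W.conjH1 2 (κ.layerSubgroup n) σ)
          (fun σ => (χ ((modNCyclotomicCharacter ℚ (2 ^ (n + 2)) σ : (ZMod (2 ^ (n + 2)))ˣ) :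
            ZMod (2 ^ (n + 2))) : ℂ)) ⊓
        W.selmerLayer κ n)


end Literature.NumberTheory.EllipticCurves

end
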